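import Summits.BirchSwinnertonDyer.BirchSwinnertonDyer.Theses.KolyvaginRankRigidityAtTwo

/-!
# Route `KolyvaginRankRigidityAtTwo`: glue of the 2-torsion split of the residual hR (LINE 8)

Item stmt-BirchSwinnertonDyer-27125 (`OffHabitatNonSurjTwoConverseGlue`, glue of the gen-3 split of the residual
stmt-BirchSwinnertonDyer-24303 `OffHabitatNonSurjTwoConverse` into R_irr stmt-27123
`OffHabitatIrredNonSurjTwoConverse` (no rational 2-torsion: `E(ℚ)[2] = ⊥`) and R_red stmt-27124
`OffHabitatRedNonSurjTwoConverse` (`E(ℚ)[2] ≠ ⊥`)). THEOREM-ONLY file (no definition, no named fact, no `sorry`).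

The glue is pure logic (excluded middle on `AddSubgroup.torsionBy E(ℚ) 2 = ⊥`). BSD is not proved by any of this; the
parent residual is not proved by this file either (it closes the GLUE item only: children ⟹ parent).
-/

set_option autoImplicit false
set_option linter.dupNamespace false

namespace Summit.BirchSwinnertonDyer.BirchSwinnertonDyer.Theorems.KolyvaginRankRigidityGlue

open Summit.BirchSwinnertonDyer.BirchSwinnertonDyer.Theses.KolyvaginRankRigidityAtTwo

/-- **Glue of the LINE-8 split of `OffHabitatNonSurjTwoConverse`** (item stmt-BirchSwinnertonDyer-27125, by name):
`OffHabitatIrredNonSurjTwoConverse → OffHabitatRedNonSurjTwoConverse → OffHabitatNonSurjTwoConverse`.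
Proof: case on whether the rational 2-torsion subgroup is trivial. [folklore] -/
theorem offHabitatNonSurjTwoConverseGlue_proof : OffHabitatNonSurjTwoConverseGlue := by
  intro hI hR W _ _ hcm hred r hr hsel hns
  by_cases h2 : AddSubgroup.torsionBy W.toAffine.Point (2 : ℤ) = ⊥
  · exact hI W hcm hred r hr hsel hns h2
  · exact hR W hcm hred r hr hsel hns h2

end Summit.BirchSwinnertonDyer.BirchSwinnertonDyer.Theorems.KolyvaginRankRigidityGlue
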